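import Summits.RiemannHypothesis.RiemannHypothesis.Theses.WeilGroundState
import Summits.RiemannHypothesis.RiemannHypothesis.Theorems.WeilRouteProps.WeilGroundState

/-!
# `Iff.rfl` bridges: Theses-free copies ↔ route propositions (route `WeilGroundState`)

LEAF module (imports the route file; nothing imports this): for every statement item `X` of route `WeilGroundState` the copy
`Summit.RiemannHypothesis.RiemannHypothesis.Theorems.WeilRouteProps.WeilGroundState.X` and the route declaration
`Summit.RiemannHypothesis.RiemannHypothesis.Theses.WeilGroundState.X` are the same proposition, by `Iff.rfl` (definitional unfolding).
If a route statement is ever restated, this file stops elaborating — the signal to re-sync the copy. Build refactor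
(21-frontier 2026-08-26T18:52:29Z); nothing here bears on the truth of RH.
-/

namespace Summit.RiemannHypothesis.RiemannHypothesis.Theorems.WeilRouteProps.WeilGroundState

/-- The Theses-free copy `WeilRouteProps.WeilGroundState.GroundStateSimpleEven` IS the route proposition `Theses.WeilGroundState.GroundStateSimpleEven` (item stmt-RiemannHypothesis-1526):
definitional unfolding (`Iff.rfl`). -/
theorem GroundStateSimpleEven_iff :
    GroundStateSimpleEven ↔ Summit.RiemannHypothesis.RiemannHypothesis.Theses.WeilGroundState.GroundStateSimpleEven :=
  Iff.rfl

/-- The Theses-free copy `WeilRouteProps.WeilGroundState.GroundStatesConvergeToXi` IS the route proposition `Theses.WeilGroundState.GroundStatesConvergeToXi` (item stmt-RiemannHypothesis-1527):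
definitional unfolding (`Iff.rfl`). -/
theorem GroundStatesConvergeToXi_iff :
    GroundStatesConvergeToXi ↔ Summit.RiemannHypothesis.RiemannHypothesis.Theses.WeilGroundState.GroundStatesConvergeToXi :=
  Iff.rfl

/-- The Theses-free copy `WeilRouteProps.WeilGroundState.GroundStateMellinRealZeros` IS the route proposition `Theses.WeilGroundState.GroundStateMellinRealZeros` (item stmt-RiemannHypothesis-1528):
definitional unfolding (`Iff.rfl`). -/
theorem GroundStateMellinRealZeros_iff :
    GroundStateMellinRealZeros ↔ Summit.RiemannHypothesis.RiemannHypothesis.Theses.WeilGroundState.GroundStateMellinRealZeros :=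
  Iff.rfl

/-- The Theses-free copy `WeilRouteProps.WeilGroundState.ArchimedeanWindowSimpleEven` IS the route proposition `Theses.WeilGroundState.ArchimedeanWindowSimpleEven` (item stmt-RiemannHypothesis-1529):
definitional unfolding (`Iff.rfl`). -/
theorem ArchimedeanWindowSimpleEven_iff :
    ArchimedeanWindowSimpleEven ↔ Summit.RiemannHypothesis.RiemannHypothesis.Theses.WeilGroundState.ArchimedeanWindowSimpleEven :=
  Iff.rfl

/-- The Theses-free copy `WeilRouteProps.WeilGroundState.MarkovPartPositiveGroundState` IS the route proposition `Theses.WeilGroundState.MarkovPartPositiveGroundState` (item stmt-RiemannHypothesis-1530):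
definitional unfolding (`Iff.rfl`). -/
theorem MarkovPartPositiveGroundState_iff :
    MarkovPartPositiveGroundState ↔ Summit.RiemannHypothesis.RiemannHypothesis.Theses.WeilGroundState.MarkovPartPositiveGroundState :=
  Iff.rfl

/-- The Theses-free copy `WeilRouteProps.WeilGroundState.SmallWindowsSimpleEven` IS the route proposition `Theses.WeilGroundState.SmallWindowsSimpleEven` (item stmt-RiemannHypothesis-1531):
definitional unfolding (`Iff.rfl`). -/
theorem SmallWindowsSimpleEven_iff :
    SmallWindowsSimpleEven ↔ Summit.RiemannHypothesis.RiemannHypothesis.Theses.WeilGroundState.SmallWindowsSimpleEven :=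
  Iff.rfl

/-- The Theses-free copy `WeilRouteProps.WeilGroundState.Assembly` IS the route proposition `Theses.WeilGroundState.Assembly` (item stmt-RiemannHypothesis-1532):
definitional unfolding (`Iff.rfl`). -/
theorem Assembly_iff :
    Assembly ↔ Summit.RiemannHypothesis.RiemannHypothesis.Theses.WeilGroundState.Assembly :=
  Iff.rfl

end Summit.RiemannHypothesis.RiemannHypothesis.Theorems.WeilRouteProps.WeilGroundState
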